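import Summits.AtomisticToContinuum.Crystallization.Theorems.FrustratedLawDichotomyHalfSpaceCapSharp

/-!
# FrustratedLawDichotomy · crux `AperiodicFrustratedLawGap` (stmt-AtomisticToContinuum-27623) — cap-sharp half-space columns for INFINITE configurations
# (hdef side, row class H, class-D side; companion of `…HalfSpaceCapSharp`; decomp-a2c, prover hand 1, gen 51)

The `tsum` forms of the cap-sharp `δ = 7/10` half-space columns of `…HalfSpaceCapSharp` (force `TH♯`, energy `SH6♯/6`), for a `7/10`-separated
`Y ⊆ ℝ³` lying beyond the plane `{⟪y − x, e⟫ ≥ d}`: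

* `norm_tsum_force_le_of_halfspace_sharp_sevenTenths` — `‖Σ'_{y ∈ Y} ((dist x y)⁻¹^8 − (dist x y)⁻¹^14) • (x − y)‖ ≤ TH♯(d)` (`d ≥ 7/20`);
* `abs_tsum_lennardJones_le_of_halfspace_sharp_sevenTenths` — `|Σ'_{y ∈ Y} V_LJ(dist x y)| ≤ (1/6)·SH6♯(d)` (`d ≥ 1`).

DEF-FREE; imports the tree's `…HalfSpaceCapSharp` only; 0 sorry.  [folklore]
-/

noncomputable section

namespace Summit.AtomisticToContinuum.Crystallization.Theorems.FrustratedLawDichotomyHalfSpaceCapSharpInfinite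

open scoped BigOperators RealInnerProductSpace
open Literature.MathematicalPhysics.StatisticalMechanics (lennardJones UniformlyDiscrete)
open Summit.AtomisticToContinuum.Crystallization.Theorems.FrustratedLawDichotomyHalfSpaceColumnInfinite (summable_force_of_halfspace)
open Summit.AtomisticToContinuum.Crystallization.Theorems.FrustratedLawDichotomyHalfSpaceCapSharp
  (sum_norm_force_le_of_separated_halfspace_sharp_sevenTenths sum_inv_pow_six_le_of_separated_halfspace_sharp_sevenTenths)

/-- ★ **Cap-sharp half-space FORCE column, infinite form** (`δ = 7/10`): for a `7/10`-separated `Y` beyond the plane at signed distance `d ≥ 7/20`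
from `x` in the unit direction `e`, `‖Σ'_{y ∈ Y} force‖ ≤ TH♯(d)`. [folklore] -/
theorem norm_tsum_force_le_of_halfspace_sharp_sevenTenths {Y : Set (EuclideanSpace ℝ (Fin 3))}
    (hsep : ∀ a ∈ Y, ∀ b ∈ Y, a ≠ b → (7 : ℝ) / 10 ≤ dist a b) (x e : EuclideanSpace ℝ (Fin 3)) (he : ‖e‖ = 1) {d : ℝ} (hd : 7 / 20 ≤ d)
    (hhalf : ∀ y ∈ Y, d ≤ ⟪y - x, e⟫) :
    ‖∑' y : ↥Y, ((dist x y)⁻¹ ^ 8 - (dist x y)⁻¹ ^ 14) • (x - (y : EuclideanSpace ℝ (Fin 3)))‖ ≤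
      7 * (4000 / 343 * d⁻¹ ^ 4 / 4 + 2000 / 343 * (63 / 20 - 3 * d) * d⁻¹ ^ 5 / 5 + 600 / 49 * (7 / 10 - d) * d⁻¹ ^ 6 / 6 +
          2000 / 343 * ((7 / 10 - d) ^ 2 * (d + 7 / 20)) * d⁻¹ ^ 7 / 7) +
        13 * (4000 / 343 * d⁻¹ ^ 10 / 10 + 2000 / 343 * (63 / 20 - 3 * d) * d⁻¹ ^ 11 / 11 + 600 / 49 * (7 / 10 - d) * d⁻¹ ^ 12 / 12 +
          2000 / 343 * ((7 / 10 - d) ^ 2 * (d + 7 / 20)) * d⁻¹ ^ 13 / 13) := by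
  classical
  have hsum := summable_force_of_halfspace (by norm_num : (0:ℝ) < 7 / 10) hsep x e he (by linarith) hhalf
  have hnorm : Summable fun y : ↥Y => ‖((dist x y)⁻¹ ^ 8 - (dist x y)⁻¹ ^ 14) • (x - (y : EuclideanSpace ℝ (Fin 3)))‖ :=
    hsum.norm
  refine (norm_tsum_le_tsum_norm hnorm).trans (hnorm.tsum_le_of_sum_le fun u => ?_)
  set u' : Finset (EuclideanSpace ℝ (Fin 3)) := u.image Subtype.val with hu'
  have hmem : ∀ y ∈ u', y ∈ Y := fun y hy => by
    rw [hu', Finset.mem_image] at hy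
    obtain ⟨w, -, rfl⟩ := hy
    exact w.2
  have hsum_eq : ∑ y ∈ u, ‖((dist x y)⁻¹ ^ 8 - (dist x y)⁻¹ ^ 14) • (x - (y : EuclideanSpace ℝ (Fin 3)))‖ =
      ∑ y ∈ u', ‖((dist x y)⁻¹ ^ 8 - (dist x y)⁻¹ ^ 14) • (x - y)‖ := by
    rw [hu', Finset.sum_image (fun a _ b _ h => Subtype.ext h)]
  rw [hsum_eq]
  exact sum_norm_force_le_of_separated_halfspace_sharp_sevenTenths u' x e he hd
    (fun a ha b hb hab => hsep a (hmem a ha) b (hmem b hb) hab) fun y hy => hhalf y (hmem y hy)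

/-- ★ **Cap-sharp half-space ENERGY column, infinite form** (`δ = 7/10`): for a `7/10`-separated `Y` beyond the plane at signed distance `d ≥ 1`,
`|Σ'_{y ∈ Y} V_LJ(dist x y)| ≤ (1/6)·SH6♯(d)`; the root-energy debit of a class-D half-space is `≤ (1/12)·(SH6♯(d) − host half-space tail)`. [folklore] -/
theorem abs_tsum_lennardJones_le_of_halfspace_sharp_sevenTenths {Y : Set (EuclideanSpace ℝ (Fin 3))}
    (hsep : ∀ a ∈ Y, ∀ b ∈ Y, a ≠ b → (7 : ℝ) / 10 ≤ dist a b) (x e : EuclideanSpace ℝ (Fin 3)) (he : ‖e‖ = 1) {d : ℝ} (hd : 1 ≤ d)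
    (hhalf : ∀ y ∈ Y, d ≤ ⟪y - x, e⟫) :
    |∑' y : ↥Y, lennardJones (dist x y)| ≤
      1 / 6 * (6 * (4000 / 343 * d⁻¹ ^ 3 / 3 + 2000 / 343 * (63 / 20 - 3 * d) * d⁻¹ ^ 4 / 4 + 600 / 49 * (7 / 10 - d) * d⁻¹ ^ 5 / 5 +
          2000 / 343 * ((7 / 10 - d) ^ 2 * (d + 7 / 20)) * d⁻¹ ^ 6 / 6)) := by
  classical
  have hY : UniformlyDiscrete Y := ⟨7 / 10, by norm_num, hsep⟩
  have hsum : Summable fun y : ↥Y => lennardJones (dist x y) := hY.summable_lennardJones_dist x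
  have habs : |∑' y : ↥Y, lennardJones (dist x y)| ≤ ∑' y : ↥Y, |lennardJones (dist x y)| := by
    have h0 : Summable fun y : ↥Y => ‖lennardJones (dist x y)‖ := hsum.norm
    have := norm_tsum_le_tsum_norm h0
    simpa only [Real.norm_eq_abs] using this
  refine habs.trans (hsum.abs.tsum_le_of_sum_le fun u => ?_)
  set u' : Finset (EuclideanSpace ℝ (Fin 3)) := u.image Subtype.val with hu'
  have hmem : ∀ y ∈ u', y ∈ Y := fun y hy => by
    rw [hu', Finset.mem_image] at hy
    obtain ⟨w, -, rfl⟩ := hy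
    exact w.2
  have hsum_eq : ∑ y ∈ u, |lennardJones (dist x y)| = ∑ y ∈ u', |lennardJones (dist x y)| := by
    rw [hu', Finset.sum_image (fun a _ b _ h => Subtype.ext h)]
  rw [hsum_eq]
  -- finite cap-sharp energy column with `|V_LJ| ≤ r⁻⁶/6` (inline, as in `…HalfSpaceEnergyColumn`)
  have hsep' : ∀ a ∈ u', ∀ b ∈ u', a ≠ b → (7 : ℝ) / 10 ≤ dist a b := fun a ha b hb hab => hsep a (hmem a ha) b (hmem b hb) hab
  have hhalf' : ∀ a ∈ u', d ≤ ⟪a - x, e⟫ := fun y hy => hhalf y (hmem y hy)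
  have hfar : ∀ a ∈ u', d ≤ dist x a := fun a ha => by
    rw [dist_comm, dist_eq_norm]
    have h1 := hhalf' a ha
    have h2 : ⟪a - x, e⟫ ≤ ‖a - x‖ * ‖e‖ := real_inner_le_norm _ _
    rw [he, mul_one] at h2
    linarith
  have hLJ : ∀ r : ℝ, 1 ≤ r → |lennardJones r| ≤ 1 / 6 * r⁻¹ ^ 6 := fun r hr => by
    have hw0 : 0 ≤ r⁻¹ ^ 6 := by positivity
    have hw1 : r⁻¹ ^ 6 ≤ 1 := pow_le_one₀ (by positivity) (inv_le_one_of_one_le₀ hr)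
    have h12 : r⁻¹ ^ 12 = r⁻¹ ^ 6 * r⁻¹ ^ 6 := by ring
    unfold lennardJones
    rw [abs_le]
    constructor
    · nlinarith [mul_nonneg hw0 hw0]
    · nlinarith [mul_le_mul_of_nonneg_left hw1 hw0]
  have hterm : ∀ a ∈ u', |lennardJones (dist x a)| ≤ 1 / 6 * (dist x a)⁻¹ ^ 6 :=
    fun a ha => hLJ _ (hd.trans (hfar a ha))
  calc ∑ a ∈ u', |lennardJones (dist x a)| ≤ ∑ a ∈ u', 1 / 6 * (dist x a)⁻¹ ^ 6 := Finset.sum_le_sum hterm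
    _ = 1 / 6 * ∑ a ∈ u', (dist x a)⁻¹ ^ 6 := by rw [Finset.mul_sum]
    _ ≤ _ := mul_le_mul_of_nonneg_left
        (sum_inv_pow_six_le_of_separated_halfspace_sharp_sevenTenths u' x e he (by linarith) hsep' hhalf') (by norm_num)

end Summit.AtomisticToContinuum.Crystallization.Theorems.FrustratedLawDichotomyHalfSpaceCapSharpInfinite

end
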